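import Literature.NumberTheory.Rogawski1990.ArchBouazizStableFamily
import HarnessLib

/-!
# The value of the stable orbital family `stOrbFamH` at the Cayley point of a wall — (I₂@cayPt)
# (Shelstad 1979 §4 Lemma 4.3 p. 25; Bouaziz 1994 §3.1 (I₂) p. 579, §3.2 (I₃) p. 580; Harish-Chandra's `F_f^A(1)`)

Topic `NumberTheory/Rogawski1990`; namespace `Literature.NumberTheory.Rogawski1990`.  THEOREMS ONLY (no definition, no instance, no notation, no axiom, no named
fact, no `sorry`).  Cell `pub/hodgecm-mathlib`, line LH3 (closer stub `stub_N9`, crux H413 = `stmt-HodgeConjecture-24833`); brick **(I₂@cayPt)** of the LH3 direct road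
(LH3-plan (g2) LAST DEALS 2026-09-02T06:54:46Z (i)); author LH5-p04 (g2).  Lane `--kind proof --supports stmt-HodgeConjecture-24833` (count-neutral).

WHAT THIS BRICK IS FOR.  The jump clause (I₃) of ★ `ArchBouazizSpaceH` at order `0` (★ `ArchBzJump.order_zero`) reads, at a semiregular wall point `s` of the compact place
`w₀ ∉ S`, the value `Ψ (insert w₀ S) (cayPt w₀ s)` of the family on the ADJACENT split chart at the Cayley point.  For the genuine family `Ψ = stOrbFamH L νH fH`
(★ `ArchBouazizStableFamily`: `bzExtend S′ (archRH S′ · stableSum S′ (chartOrbH L νH S′ fH))`) that point is a REAL wall point of the split chart `S′ = insert w₀ S`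
(`x_{w₀} = 0`, ★ `archRH_insert_cayPt`), so by the SEAM RULING (★ `bzExtend`) the value is `extendFrom (RegS S′) F (cayPt w₀ s)`: the limit of
`F = archRH S′ · stableSum S′ (chartOrbH …)` along `𝓝[RegS S′] (cayPt w₀ s)` WHEN IT EXISTS — a JOINT limit in all chart coordinates (Harish-Chandra: `'F_f^A` extends
continuously to the semiregular point; Bouaziz's (I₂)).  The organ J (`stub_N9jumpAgreement`) pins the jump constant `jcH S w₀` on ONE product bump function by
dividing the (K0±) jump by this value; this file supplies the value in closed form from PER-PLACE limits.

WHAT IS PROVED (group-free §1–§2 over any finite index type `W`; docking §3 on `W = {w : InfinitePlace L // IsComplex w}`).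
* §1 THE WALL VALUE IS A LIMIT: `bzExtend_eq_of_tendsto` (`c ∈ InRegS S ∖ RegS S`, `c ∈ closure (RegS S)`, `Tendsto F (𝓝[RegS S] c) (𝓝 ℓ)` ⟹ `bzExtend S F c = ℓ`;
  Mathlib `extendFrom_eq`, `ℂ` is T₂); the Cayley point of a semiregular wall point is such a `c`: `cayPt_not_mem_regS_insert`, `cayPt_mem_inRegS_insert_of_semiregular`,
  `mem_closure_regS_of_regular_off` ∕ `cayPt_mem_closure_regS_insert` (the curve `x_{w₀} = ε`, `ε → 0`, `ε ≠ 0`).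
* §2 PRODUCT CALCULUS (what J's product bump needs; no orbital-integral analysis): `archRH S` IS a per-place product (★ definition), and for a functional of product form
  `Φ c = G c · ∏_w φ w (c w)` with `G` flip-invariant the stable sum FACTORISES — `stableSum_eq_mul_prod_of_prod`:
  `stableSum S Φ c = G c · ∏_w (w ∈ S ? φ w (c w) : φ w (c w) + φ w (c w)^flip)` (Mathlib `Finset.prod_add` over the compact places) — hence
  `archRH_mul_stableSum_eq_mul_prod`: `archRH S c · stableSum S Φ c = G c · ∏_w L_w (c w)` with the LOCAL FACTORS `L_w v = |e^{v₀} − e^{−v₀}| · φ w v` (split) ∕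
  `(1 − e^{i(v₂ − v₀)}) · (φ w v + φ w v^flip)` (compact); and the limit along `𝓝[RegS S] s` is the product of the per-place limits along the local regular sets
  (`tendsto_prod_eval_nhdsWithin_regS`, `tendsto_archRH_mul_stableSum_of_prod`; `RegS S = ⋂_w eval_w⁻¹(local regular set)`, Mathlib `tendsto_finsetProd`).
* §3 DOCKING: `stOrbFamH_eq_of_tendsto`, `stOrbFamH_insert_cayPt_eq_of_tendsto` («EXISTS as the `extendFrom` limit», ANY `fH`), and the closed form for product readings
  **`stOrbFamH_insert_cayPt_eq_mul_prod`**: given the product reading of the chart functional on `RegS (insert w₀ S)` ((PROD-QUOT-H) (P1) BY STATEMENT: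
  `chartOrbH L νH (insert w₀ S) fH c = G c · ∏_w φ w (c w)`), the limit of `G`, the (A0)-limit AT `w₀` BY STATEMENT in local-functional currency
  (`Tendsto (v ↦ |e^{v₀}−e^{−v₀}| · φ w₀ v) (𝓝[{v | v₀ ≠ 0}] (0, s w₀ 1, s w₀ 0)) (𝓝 ℓ₀)` — Harish-Chandra's `'F_f^A(1)` = Rao's two-nappe cone value, (A0-b) of F0P3a-p05 (g19)
  after the local frame docking) and the limits of the regular local factors at the other places, the wall value is `g₀ · ∏_w ℓ w`; `…_of_continuousAt` spells the
  other places' limits out from plain continuity of the local functionals at the (regular) local points.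
* §4 (EDITION 2, append-only): docking glue `tendsto_nhdsWithin_of_eqOn_of_continuousAt` ∕ `tendsto_absExpSub_mul_of_eqOn_of_continuousAt` (an identity on
  the restricted set + continuity of the right-hand side at the base point ⟹ the BY-STATEMENT `Tendsto` binders) and `stOrbFamH_insert_cayPt_ne_zero_of_prod` (the Cayley
  value of a product reading is non-zero when every local limit is).
NOT HERE: the per-place analysis ((A0-b) at `w₀`: ★-in-flight `ArchRankOneSplitOrbitChart`; continuity of the elliptic∕hyperbolic local functionals at regular points),
the product reading (P1) itself ((PROD-QUOT-H), LH3-p03 (g3)), and the general-`fH` version via the partial function (P2) (needs an equicontinuity clause at `w₀`).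
HONEST LABEL: HC_CM is proved only modulo the 7 printed citations (2 remaining: hLiu418 = stmt-HodgeConjecture-24832, h413 = stmt-HodgeConjecture-24833) until rung 0
closes; coordinate∕filter bookkeeping, pays nothing by itself (count-neutral).

## References
* [Shelstad1979] D. Shelstad, *Characters and inner forms of a quasi-split group over ℝ*, Compositio Math. 39 (1979) 11–45, §4 Lemma 4.3 p. 25 (the Cayley transform data
  `γ₀ = γ₀^s`, `F^{T′}` at the semiregular point), Thm. 4.7 (IIIb) p. 31.
* [Bouaziz1994IntegralesOrbitales] A. Bouaziz, *Intégrales orbitales sur les groupes de Lie réductifs*, Ann. Sci. ÉNS 27 (1994) 573–609, §3.1 (I₂) p. 579 (`b_Ψ φ` extends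
  across the semiregular real walls), §3.2 (I₃) p. 580, §6.2 p. 591.
* [Rogawski1990] J. D. Rogawski, *Automorphic Representations of Unitary Groups in Three Variables*, Ann. of Math. Stud. 123 (1990), §4.1 (4.1.1) p. 39, §8.2 p. 122.
-/

set_option autoImplicit false

noncomputable section

open Filter Topology MeasureTheory NumberField NumberField.InfinitePlace Complex Set Function Real
open Literature.NumberTheory.Automorphic Literature.NumberTheory.Automorphic.UnitaryGroup Literature.NumberTheory.Automorphic.ArchCartan

namespace Literature.NumberTheory.Rogawski1990

/-! ## §1 The wall value of `bzExtend` is the limit from the regular set, when that limit exists -/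

section WallValue

variable {W : Type*} [Fintype W] [DecidableEq W]

omit [Fintype W] [DecidableEq W] in
/-- **THE WALL VALUE IS A LIMIT**: at a point of `InRegS S` off `RegS S` (a real wall of the chart `S`) that lies in the closure of `RegS S`, if `F` has a limit `ℓ`
along `𝓝[RegS S] c` then `bzExtend S F c = ℓ` (Mathlib `extendFrom_eq`; `ℂ` is Hausdorff).  This is Bouaziz's (I₂) read as a definition of the value.
[cite: Bouaziz1994IntegralesOrbitales, §3.1 (I₂) p. 579] [cite: Shelstad1979, Lemma 4.3 (p. 25)] -/
theorem bzExtend_eq_of_tendsto (S : Finset W) (F : (W → Fin 3 → ℝ) → ℂ) {c : W → Fin 3 → ℝ} (h₁ : c ∈ InRegS S) (h₂ : c ∉ RegS S)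
    (h₃ : c ∈ closure (RegS S)) {ℓ : ℂ} (hF : Tendsto F (𝓝[RegS S] c) (𝓝 ℓ)) : bzExtend S F c = ℓ := by
  rw [bzExtend_of_mem_inRegS_of_not_mem_regS S F h₁ h₂]
  exact extendFrom_eq h₃ hF

omit [Fintype W] in
/-- The Cayley point at `w₀` is NOT in the regular set of any chart in which `w₀` is split (`x_{w₀} = 0`). [cite: Shelstad1979, Lemma 4.3 (p. 25)] -/
theorem cayPt_not_mem_regS_of_mem {S' : Finset W} {w₀ : W} (hw₀ : w₀ ∈ S') (s : W → Fin 3 → ℝ) : cayPt w₀ s ∉ RegS S' :=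
  fun h => h.2 w₀ hw₀ (cayPt_apply_self_zero w₀ s)

omit [Fintype W] in
/-- The Cayley point at `w₀` is not in `RegS (insert w₀ S)`. [cite: Shelstad1979, Lemma 4.3 (p. 25)] -/
theorem cayPt_not_mem_regS_insert (S : Finset W) (w₀ : W) (s : W → Fin 3 → ℝ) : cayPt w₀ s ∉ RegS (insert w₀ S) :=
  cayPt_not_mem_regS_of_mem (Finset.mem_insert_self w₀ S) s

omit [Fintype W] in
/-- A semiregular wall point `s` of the compact place `w₀ ∉ S` (regular at every other compact place — the hypotheses of ★ `ArchBzJump`) has its Cayley point in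
`InRegS (insert w₀ S)` (the place `w₀` is split there, hence not read). [cite: Bouaziz1994IntegralesOrbitales, §6.2 p. 591] -/
theorem cayPt_mem_inRegS_insert_of_semiregular (S : Finset W) (w₀ : W) {s : W → Fin 3 → ℝ}
    (hreg : ∀ w, w ∉ S → w ≠ w₀ → Circle.exp (s w 0) ≠ Circle.exp (s w 2)) : cayPt w₀ s ∈ InRegS (insert w₀ S) := by
  intro w hw
  rw [Finset.mem_insert, not_or] at hw
  rw [cayPt_apply_of_ne hw.1]
  exact hreg w hw.2 hw.1

omit [Fintype W] in
/-- **A point regular at every place except possibly the SPLIT place `w₀` lies in the closure of `RegS S′`**: move `x_{w₀}` by `ε ≠ 0`, `ε → 0` (the other coordinates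
are untouched, so the moved point is regular for every small `ε ≠ 0`). [cite: Shelstad1979, Lemma 4.3 (p. 25)] [cite: Bouaziz1994IntegralesOrbitales, §3.1 p. 579] -/
theorem mem_closure_regS_of_regular_off {S' : Finset W} {w₀ : W} (hw₀ : w₀ ∈ S') {c : W → Fin 3 → ℝ}
    (hcpt : ∀ w, w ∉ S' → Circle.exp (c w 0) ≠ Circle.exp (c w 2)) (hsplit : ∀ w ∈ S', w ≠ w₀ → c w 0 ≠ 0) : c ∈ closure (RegS S') := by
  -- the curve `ε ↦ c + ε • e_{(w₀,0)}`
  let e : W → Fin 3 → ℝ := Pi.single w₀ (Pi.single 0 1)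
  let γ : ℝ → W → Fin 3 → ℝ := fun ε => c + ε • e
  have hγ0 : γ 0 = c := by
    simp only [γ, zero_smul, add_zero]
  have hγc : Continuous γ := continuous_const.add (continuous_id.smul continuous_const)
  have hlim : Tendsto γ (𝓝[≠] (0 : ℝ)) (𝓝 c) := by
    rw [← hγ0]
    exact (hγc.tendsto 0).mono_left nhdsWithin_le_nhds
  have hoff : ∀ ε, ∀ w, w ≠ w₀ → γ ε w = c w := fun ε w hne => by
    simp only [γ, e, Pi.add_apply, Pi.smul_apply, Pi.single_eq_of_ne hne, smul_zero, add_zero]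
  have hon : ∀ ε, γ ε w₀ 0 = c w₀ 0 + ε := fun ε => by
    simp only [γ, e, Pi.add_apply, Pi.smul_apply, Pi.single_eq_same, smul_eq_mul, mul_one]
  -- for every small `ε ≠ 0` the moved split coordinate `c w₀ 0 + ε` is non-zero
  have hev : ∀ᶠ ε in 𝓝[≠] (0 : ℝ), c w₀ 0 + ε ≠ 0 := by
    by_cases ha : c w₀ 0 = 0
    · exact eventually_nhdsWithin_of_forall fun ε hε => by rwa [ha, zero_add]
    · have hmem : {ε : ℝ | c w₀ 0 + ε ≠ 0} ∈ 𝓝 (0 : ℝ) := by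
        refine (isOpen_ne_fun (f := fun ε : ℝ => c w₀ 0 + ε) (g := fun _ : ℝ => (0 : ℝ)) (by fun_prop) continuous_const).mem_nhds ?_
        rw [mem_setOf_eq, add_zero]
        exact ha
      exact mem_nhdsWithin_of_mem_nhds hmem
  refine mem_closure_of_tendsto hlim (hev.mono fun ε hε => ?_)
  refine ⟨fun w hw => ?_, fun w hw => ?_⟩
  · have hne : w ≠ w₀ := fun h => hw (h ▸ hw₀)
    rw [hoff ε w hne]
    exact hcpt w hw
  · by_cases h : w = w₀
    · subst h
      rw [hon ε]
      exact hε
    · rw [hoff ε w h]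
      exact hsplit w hw h

omit [Fintype W] in
/-- **The Cayley point of a semiregular wall point lies in the closure of the regular set of the adjacent split chart** `insert w₀ S` (hypotheses of ★ `ArchBzJump`:
regular at the compact places `w ≠ w₀` and at the split places). [cite: Shelstad1979, Lemma 4.3 (p. 25)] -/
theorem cayPt_mem_closure_regS_insert (S : Finset W) (w₀ : W) {s : W → Fin 3 → ℝ}
    (hreg : ∀ w, w ∉ S → w ≠ w₀ → Circle.exp (s w 0) ≠ Circle.exp (s w 2)) (hregS : ∀ w ∈ S, s w 0 ≠ 0) :
    cayPt w₀ s ∈ closure (RegS (insert w₀ S)) := by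
  refine mem_closure_regS_of_regular_off (Finset.mem_insert_self w₀ S) (fun w hw => ?_) (fun w hw hne => ?_)
  · rw [Finset.mem_insert, not_or] at hw
    rw [cayPt_apply_of_ne hw.1]
    exact hreg w hw.2 hw.1
  · rw [cayPt_apply_of_ne hne]
    rcases Finset.mem_insert.1 hw with h | h
    · exact absurd h hne
    · exact hregS w h

omit [Fintype W] in
/-- **THE CAYLEY-POINT VALUE OF A WALL-EXTENDED FAMILY IS THE LIMIT FROM THE REGULAR SET OF THE SPLIT CHART** (when it exists): for `w₀ ∉ S`-or-not, a semiregular `s`,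
`Tendsto F (𝓝[RegS (insert w₀ S)] (cayPt w₀ s)) (𝓝 ℓ) ⟹ bzExtend (insert w₀ S) F (cayPt w₀ s) = ℓ`. [cite: Bouaziz1994IntegralesOrbitales, §3.1 (I₂) p. 579]
[cite: Shelstad1979, Lemma 4.3 (p. 25)] -/
theorem bzExtend_insert_cayPt_eq_of_tendsto (S : Finset W) (w₀ : W) (F : (W → Fin 3 → ℝ) → ℂ) {s : W → Fin 3 → ℝ}
    (hreg : ∀ w, w ∉ S → w ≠ w₀ → Circle.exp (s w 0) ≠ Circle.exp (s w 2)) (hregS : ∀ w ∈ S, s w 0 ≠ 0)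
    {ℓ : ℂ} (hF : Tendsto F (𝓝[RegS (insert w₀ S)] (cayPt w₀ s)) (𝓝 ℓ)) : bzExtend (insert w₀ S) F (cayPt w₀ s) = ℓ :=
  bzExtend_eq_of_tendsto (insert w₀ S) F (cayPt_mem_inRegS_insert_of_semiregular S w₀ hreg) (cayPt_not_mem_regS_insert S w₀ s)
    (cayPt_mem_closure_regS_insert S w₀ hreg hregS) hF

end WallValue

/-! ## §2 Product calculus: `archRH` and the stable sum of a product functional factorise placewise; the limit along `RegS` is the product of per-place limits -/

section ProductCalculus

variable {W : Type*} [Fintype W] [DecidableEq W]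

omit [Fintype W] in
/-- `flipSet T` at a place of `T` flips the local triple, elsewhere it does nothing — as ONE formula. [cite: Shelstad1979, §4 p. 23] -/
theorem flipSet_apply (T : Finset W) (c : W → Fin 3 → ℝ) (w : W) : flipSet T c w = if w ∈ T then ![c w 2, c w 1, c w 0] else c w := by
  by_cases h : w ∈ T
  · rw [flipSet_apply_of_mem h, if_pos h]
  · rw [flipSet_apply_of_not_mem h, if_neg h]

/-- **THE STABLE SUM OF A PRODUCT FUNCTIONAL FACTORISES**: if on `RegS S` the functional reads `Φ c = G c · ∏_w φ w (c w)` with `G` invariant under the flips at the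
compact places, then for `c ∈ RegS S`
`stableSum S Φ c = G c · ∏_w (if w ∈ S then φ w (c w) else φ w (c w) + φ w (c w)^flip)` — the `2^{#compact places}` flipped terms are the expansion of the product of
the two-term sums (Mathlib `Finset.prod_add`). [cite: Shelstad1979, §4 p. 23] [cite: Rogawski1990, §4.1 (4.1.1) p. 39] -/
theorem stableSum_eq_mul_prod_of_prod (S : Finset W) {Φ G : (W → Fin 3 → ℝ) → ℂ} {φ : W → (Fin 3 → ℝ) → ℂ}
    (hΦ : ∀ c ∈ RegS S, Φ c = G c * ∏ w, φ w (c w)) (hG : ∀ T : Finset W, (∀ w ∈ T, w ∉ S) → ∀ c, G (flipSet T c) = G c)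
    {c : W → Fin 3 → ℝ} (hc : c ∈ RegS S) :
    stableSum S Φ c = G c * ∏ w, (if w ∈ S then φ w (c w) else φ w (c w) + φ w ![c w 2, c w 1, c w 0]) := by
  classical
  rw [stableSum_def]
  -- each flipped term, read through `hΦ`
  have hterm : ∀ T ∈ (Finset.univ \ S).powerset,
      Φ (flipSet T c) = G c * ((∏ w ∈ S, φ w (c w)) * ((∏ w ∈ T, φ w ![c w 2, c w 1, c w 0]) * ∏ w ∈ (Finset.univ \ S) \ T, φ w (c w))) := by
    intro T hT
    have hTS : ∀ w ∈ T, w ∉ S := not_mem_of_mem_powerset_sdiff hT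
    have hTsub : T ⊆ Finset.univ \ S := Finset.mem_powerset.1 hT
    rw [hΦ _ ((flipSet_mem_regS_iff S hTS c).2 hc), hG T hTS c]
    congr 1
    -- split `∏ w` into `S` and `univ ∖ S`, then `univ ∖ S` into `T` and the rest
    rw [← Finset.prod_mul_prod_compl S, Finset.compl_eq_univ_sdiff, ← Finset.prod_sdiff hTsub]
    have h1 : ∏ w ∈ S, φ w (flipSet T c w) = ∏ w ∈ S, φ w (c w) :=
      Finset.prod_congr rfl fun w hw => by rw [flipSet_apply_of_not_mem (fun hT' => hTS w hT' hw)]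
    have h2 : ∏ w ∈ T, φ w (flipSet T c w) = ∏ w ∈ T, φ w ![c w 2, c w 1, c w 0] :=
      Finset.prod_congr rfl fun w hw => by rw [flipSet_apply_of_mem hw]
    have h3 : ∏ w ∈ (Finset.univ \ S) \ T, φ w (flipSet T c w) = ∏ w ∈ (Finset.univ \ S) \ T, φ w (c w) :=
      Finset.prod_congr rfl fun w hw => by rw [flipSet_apply_of_not_mem (Finset.mem_sdiff.1 hw).2]
    rw [h1, h2, h3, mul_comm (∏ w ∈ (Finset.univ \ S) \ T, φ w (c w))]
  rw [Finset.sum_congr rfl hterm, ← Finset.mul_sum, ← Finset.mul_sum]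
  congr 1
  -- the target product, split the same way
  rw [← Finset.prod_mul_prod_compl S (fun w => if w ∈ S then φ w (c w) else φ w (c w) + φ w ![c w 2, c w 1, c w 0]),
    Finset.compl_eq_univ_sdiff]
  have h4 : ∏ w ∈ S, (if w ∈ S then φ w (c w) else φ w (c w) + φ w ![c w 2, c w 1, c w 0]) = ∏ w ∈ S, φ w (c w) :=
    Finset.prod_congr rfl fun w hw => by rw [if_pos hw]
  have h5 : ∏ w ∈ Finset.univ \ S, (if w ∈ S then φ w (c w) else φ w (c w) + φ w ![c w 2, c w 1, c w 0]) =
      ∏ w ∈ Finset.univ \ S, (φ w ![c w 2, c w 1, c w 0] + φ w (c w)) :=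
    Finset.prod_congr rfl fun w hw => by rw [if_neg (Finset.mem_sdiff.1 hw).2, add_comm]
  rw [h4, h5, Finset.prod_add]

/-- **`archRH S` times the stable sum of a product functional is ONE product of LOCAL FACTORS**: at a split place `|e^{x} − e^{−x}| · φ w (c w)`, at a compact place
`(1 − e^{i(θ₂ − θ₀)}) · (φ w (c w) + φ w (c w)^flip)` (★ `archRH` is the per-place product of Shelstad's root factors). [cite: Shelstad1979, §4 p. 22–23] -/
theorem archRH_mul_stableSum_eq_mul_prod (S : Finset W) {Φ G : (W → Fin 3 → ℝ) → ℂ} {φ : W → (Fin 3 → ℝ) → ℂ}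
    (hΦ : ∀ c ∈ RegS S, Φ c = G c * ∏ w, φ w (c w)) (hG : ∀ T : Finset W, (∀ w ∈ T, w ∉ S) → ∀ c, G (flipSet T c) = G c)
    {c : W → Fin 3 → ℝ} (hc : c ∈ RegS S) :
    archRH S c * stableSum S Φ c =
      G c * ∏ w, (if w ∈ S then (((|Real.exp (c w 0) - Real.exp (-c w 0)| : ℝ) : ℂ) * φ w (c w))
        else (1 - (Circle.exp (c w 2 - c w 0) : ℂ)) * (φ w (c w) + φ w ![c w 2, c w 1, c w 0])) := by
  rw [stableSum_eq_mul_prod_of_prod S hΦ hG hc, mul_left_comm]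
  congr 1
  unfold archRH
  rw [← Finset.prod_mul_distrib]
  refine Finset.prod_congr rfl fun w _ => ?_
  split_ifs <;> rfl

omit [Fintype W] in
/-- **Along `𝓝[RegS S] s` every coordinate projection tends to its value WITHIN the local regular set** (split place: `x ≠ 0`; compact place: `e^{iθ₀} ≠ e^{iθ₂}`) —
`RegS S` is the intersection of the preimages of the local regular sets. [cite: Shelstad1979, §4 p. 22] -/
theorem tendsto_eval_nhdsWithin_regS (S : Finset W) (s : W → Fin 3 → ℝ) (w : W) :
    Tendsto (fun c : W → Fin 3 → ℝ => c w) (𝓝[RegS S] s)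
      (𝓝[if w ∈ S then {v : Fin 3 → ℝ | v 0 ≠ 0} else {v : Fin 3 → ℝ | Circle.exp (v 0) ≠ Circle.exp (v 2)}] (s w)) := by
  refine ((continuous_apply w).continuousWithinAt).tendsto_nhdsWithin fun c hc => ?_
  by_cases hw : w ∈ S
  · rw [if_pos hw]
    exact hc.2 w hw
  · rw [if_neg hw]
    exact hc.1 w hw

/-- **The limit along `𝓝[RegS S] s` of a product of local factors is the product of the per-place limits along the local regular sets** (Mathlib
`tendsto_finsetProd` over `tendsto_eval_nhdsWithin_regS`). [cite: Shelstad1979, §4 p. 22] [cite: Bouaziz1994IntegralesOrbitales, §3.1 p. 579] -/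
theorem tendsto_prod_eval_nhdsWithin_regS (S : Finset W) {Lf : W → (Fin 3 → ℝ) → ℂ} {ℓ : W → ℂ} (s : W → Fin 3 → ℝ)
    (h : ∀ w, Tendsto (Lf w) (𝓝[if w ∈ S then {v : Fin 3 → ℝ | v 0 ≠ 0} else {v : Fin 3 → ℝ | Circle.exp (v 0) ≠ Circle.exp (v 2)}] (s w)) (𝓝 (ℓ w))) :
    Tendsto (fun c : W → Fin 3 → ℝ => ∏ w, Lf w (c w)) (𝓝[RegS S] s) (𝓝 (∏ w, ℓ w)) :=
  tendsto_finsetProd Finset.univ fun w _ => (h w).comp (tendsto_eval_nhdsWithin_regS S s w)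

/-- **THE LIMIT OF `archRH S · stableSum S Φ` ALONG THE REGULAR SET FOR A PRODUCT FUNCTIONAL**: per-place limits of the local factors (split: `|e^{x}−e^{−x}| · φ w`;
compact: `(1 − e^{i(θ₂−θ₀)}) · (φ w + φ w ∘ flip)`) along the local regular sets and a limit of the flip-invariant prefactor `G` give the limit `g₀ · ∏_w ℓ w` — at ANY base
point `s` (regular or on a real wall). [cite: Shelstad1979, §4 p. 22–25] [cite: Bouaziz1994IntegralesOrbitales, §3.1 (I₂) p. 579] -/
theorem tendsto_archRH_mul_stableSum_of_prod (S : Finset W) {Φ G : (W → Fin 3 → ℝ) → ℂ} {φ : W → (Fin 3 → ℝ) → ℂ}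
    (hΦ : ∀ c ∈ RegS S, Φ c = G c * ∏ w, φ w (c w)) (hG : ∀ T : Finset W, (∀ w ∈ T, w ∉ S) → ∀ c, G (flipSet T c) = G c)
    (s : W → Fin 3 → ℝ) {g₀ : ℂ} (hGt : Tendsto G (𝓝[RegS S] s) (𝓝 g₀)) {ℓ : W → ℂ}
    (hsplit : ∀ w ∈ S, Tendsto (fun v : Fin 3 → ℝ => (((|Real.exp (v 0) - Real.exp (-v 0)| : ℝ) : ℂ) * φ w v))
      (𝓝[{v : Fin 3 → ℝ | v 0 ≠ 0}] (s w)) (𝓝 (ℓ w)))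
    (hcpt : ∀ w, w ∉ S → Tendsto (fun v : Fin 3 → ℝ => (1 - (Circle.exp (v 2 - v 0) : ℂ)) * (φ w v + φ w ![v 2, v 1, v 0]))
      (𝓝[{v : Fin 3 → ℝ | Circle.exp (v 0) ≠ Circle.exp (v 2)}] (s w)) (𝓝 (ℓ w))) :
    Tendsto (fun c => archRH S c * stableSum S Φ c) (𝓝[RegS S] s) (𝓝 (g₀ * ∏ w, ℓ w)) := by
  -- on `RegS S` the function IS `G c · ∏_w L_w (c w)`
  have heq : EqOn (fun c => archRH S c * stableSum S Φ c)
      (fun c => G c * ∏ w, (if w ∈ S then (((|Real.exp (c w 0) - Real.exp (-c w 0)| : ℝ) : ℂ) * φ w (c w))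
        else (1 - (Circle.exp (c w 2 - c w 0) : ℂ)) * (φ w (c w) + φ w ![c w 2, c w 1, c w 0]))) (RegS S) :=
    fun c hc => archRH_mul_stableSum_eq_mul_prod S hΦ hG hc
  refine Tendsto.congr' (eventuallyEq_nhdsWithin_of_eqOn heq).symm (hGt.mul ?_)
  refine tendsto_prod_eval_nhdsWithin_regS S s
    (Lf := fun w v => if w ∈ S then (((|Real.exp (v 0) - Real.exp (-v 0)| : ℝ) : ℂ) * φ w v)
      else (1 - (Circle.exp (v 2 - v 0) : ℂ)) * (φ w v + φ w ![v 2, v 1, v 0])) fun w => ?_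
  by_cases hw : w ∈ S
  · simp only [if_pos hw]
    exact hsplit w hw
  · simp only [if_neg hw]
    exact hcpt w hw

end ProductCalculus

/-! ## §3 Docking: the Cayley-point value of `stOrbFamH` -/

section StOrbFamH

open scoped Classical

variable (L : Type) [Field L] [NumberField L] [IsCMField L]
  [MeasurableSpace (↥(arch (↥(maximalRealSubfield L)) L (IsCMField.complexConj L) 2 (Matrix.of fun i j : Fin 2 => if i.val + j.val + 1 = 2 then (1 : L) else 0)) ×
      ↥(arch (↥(maximalRealSubfield L)) L (IsCMField.complexConj L) 1 (Matrix.of fun i j : Fin 1 => if i.val + j.val + 1 = 1 then (1 : L) else 0)))]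
  [BorelSpace (↥(arch (↥(maximalRealSubfield L)) L (IsCMField.complexConj L) 2 (Matrix.of fun i j : Fin 2 => if i.val + j.val + 1 = 2 then (1 : L) else 0)) ×
      ↥(arch (↥(maximalRealSubfield L)) L (IsCMField.complexConj L) 1 (Matrix.of fun i j : Fin 1 => if i.val + j.val + 1 = 1 then (1 : L) else 0)))]
  (νH : Measure (↥(arch (↥(maximalRealSubfield L)) L (IsCMField.complexConj L) 2 (Matrix.of fun i j : Fin 2 => if i.val + j.val + 1 = 2 then (1 : L) else 0)) ×
      ↥(arch (↥(maximalRealSubfield L)) L (IsCMField.complexConj L) 1 (Matrix.of fun i j : Fin 1 => if i.val + j.val + 1 = 1 then (1 : L) else 0))))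
  [IsFiniteMeasureOnCompacts νH] [νH.IsMulRightInvariant]

/-- **THE VALUE OF `stOrbFamH` AT A REAL WALL POINT IS THE LIMIT OF `R_S · Σ chartOrbH` FROM THE REGULAR SET**, when that limit exists (any `fH`, any chart `S`).
[cite: Bouaziz1994IntegralesOrbitales, §3.1 (I₂) p. 579; §6.2 p. 591] [cite: Shelstad1979, §4 p. 24] -/
theorem stOrbFamH_eq_of_tendsto
    (fH : ↥(arch (↥(maximalRealSubfield L)) L (IsCMField.complexConj L) 2 (Matrix.of fun i j : Fin 2 => if i.val + j.val + 1 = 2 then (1 : L) else 0)) ×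
      ↥(arch (↥(maximalRealSubfield L)) L (IsCMField.complexConj L) 1 (Matrix.of fun i j : Fin 1 => if i.val + j.val + 1 = 1 then (1 : L) else 0)) → ℂ)
    (S : Finset {w : InfinitePlace L // IsComplex w}) {c : {w : InfinitePlace L // IsComplex w} → Fin 3 → ℝ}
    (h₁ : c ∈ InRegS S) (h₂ : c ∉ RegS S) (h₃ : c ∈ closure (RegS S)) {ℓ : ℂ}
    (hF : Tendsto (fun c => archRH S c * stableSum S (chartOrbH L νH S fH) c) (𝓝[RegS S] c) (𝓝 ℓ)) :
    stOrbFamH L νH fH S c = ℓ := by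
  rw [stOrbFamH_def]
  exact bzExtend_eq_of_tendsto S _ h₁ h₂ h₃ hF

/-- **(I₂@cayPt), EXISTENCE FORM — THE CAYLEY-POINT VALUE READ BY (I₃) IS THE LIMIT FROM THE SPLIT CHART'S REGULAR SET**: for a compact place `w₀ ∉ S`, a semiregular
wall point `s` (regular at the other places — ★ `ArchBzJump`'s hypotheses; `s w₀ 0 = s w₀ 2` is not even needed) and ANY `fH`, if `archRH S′ · stableSum S′ (chartOrbH … S′ fH)`,
`S′ = insert w₀ S`, tends to `ℓ` along `𝓝[RegS S′] (cayPt w₀ s)`, then `stOrbFamH L νH fH S′ (cayPt w₀ s) = ℓ` (Harish-Chandra's `'F_f^A(1)`; Bouaziz (I₂)).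
[cite: Shelstad1979, Lemma 4.3 (p. 25)] [cite: Bouaziz1994IntegralesOrbitales, §3.1 (I₂) p. 579; §3.2 (I₃) p. 580] -/
theorem stOrbFamH_insert_cayPt_eq_of_tendsto
    (fH : ↥(arch (↥(maximalRealSubfield L)) L (IsCMField.complexConj L) 2 (Matrix.of fun i j : Fin 2 => if i.val + j.val + 1 = 2 then (1 : L) else 0)) ×
      ↥(arch (↥(maximalRealSubfield L)) L (IsCMField.complexConj L) 1 (Matrix.of fun i j : Fin 1 => if i.val + j.val + 1 = 1 then (1 : L) else 0)) → ℂ)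
    (S : Finset {w : InfinitePlace L // IsComplex w}) (w₀ : {w : InfinitePlace L // IsComplex w}) {s : {w : InfinitePlace L // IsComplex w} → Fin 3 → ℝ}
    (hreg : ∀ w, w ∉ S → w ≠ w₀ → Circle.exp (s w 0) ≠ Circle.exp (s w 2)) (hregS : ∀ w ∈ S, s w 0 ≠ 0) {ℓ : ℂ}
    (hF : Tendsto (fun c => archRH (insert w₀ S) c * stableSum (insert w₀ S) (chartOrbH L νH (insert w₀ S) fH) c)
      (𝓝[RegS (insert w₀ S)] (cayPt w₀ s)) (𝓝 ℓ)) :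
    stOrbFamH L νH fH (insert w₀ S) (cayPt w₀ s) = ℓ := by
  rw [stOrbFamH_def]
  exact bzExtend_insert_cayPt_eq_of_tendsto S w₀ _ hreg hregS hF

/-- **(I₂@cayPt), CLOSED FORM FOR PRODUCT READINGS** — the value the organ J divides by.  At a compact place `w₀ ∉ S` and a semiregular wall point `s` (`s w₀ 0 = s w₀ 2`,
regular elsewhere), for a test function whose chart functional on `S′ = insert w₀ S` has the PRODUCT READING `chartOrbH L νH S′ fH c = G c · ∏_w φ w (c w)` on
`RegS S′` ((PROD-QUOT-H) (P1): product test functions; `G` = the `U(Φ₁)`-factor, invariant under the compact flips, with limit `g₀` at the Cayley point), given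
* AT `w₀` the split-rank-one limit BY STATEMENT — `|e^{x} − e^{−x}| · φ w₀ (x, θ₁, θ) → ℓ w₀` as `(x, θ₁, θ) → (0, s w₀ 1, s w₀ 0)` within `x ≠ 0` (Harish-Chandra: the
  normalised hyperbolic orbital integral extends continuously to the semiregular point, value = Rao's two-nappe cone integral — (A0-b) after the local frame docking),
* at the split places `w ∈ S` and the compact places `w ∉ S′` the limits `ℓ w` of the (regular) local factors along the local regular sets,
the Cayley-point value is **`stOrbFamH L νH fH (insert w₀ S) (cayPt w₀ s) = g₀ · ∏_w ℓ w`**. [cite: Shelstad1979, Lemma 4.3 (p. 25); §4 p. 22–23]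
[cite: Bouaziz1994IntegralesOrbitales, §3.1 (I₂) p. 579; §3.2 (I₃) p. 580] [cite: Rogawski1990, §8.2 p. 122] -/
theorem stOrbFamH_insert_cayPt_eq_mul_prod
    (fH : ↥(arch (↥(maximalRealSubfield L)) L (IsCMField.complexConj L) 2 (Matrix.of fun i j : Fin 2 => if i.val + j.val + 1 = 2 then (1 : L) else 0)) ×
      ↥(arch (↥(maximalRealSubfield L)) L (IsCMField.complexConj L) 1 (Matrix.of fun i j : Fin 1 => if i.val + j.val + 1 = 1 then (1 : L) else 0)) → ℂ)
    (S : Finset {w : InfinitePlace L // IsComplex w}) {w₀ : {w : InfinitePlace L // IsComplex w}} (hw₀ : w₀ ∉ S)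
    {s : {w : InfinitePlace L // IsComplex w} → Fin 3 → ℝ} (hs : s w₀ 0 = s w₀ 2)
    (hreg : ∀ w, w ∉ S → w ≠ w₀ → Circle.exp (s w 0) ≠ Circle.exp (s w 2)) (hregS : ∀ w ∈ S, s w 0 ≠ 0)
    {G : ({w : InfinitePlace L // IsComplex w} → Fin 3 → ℝ) → ℂ} {φ : {w : InfinitePlace L // IsComplex w} → (Fin 3 → ℝ) → ℂ}
    (hP1 : ∀ c ∈ RegS (insert w₀ S), chartOrbH L νH (insert w₀ S) fH c = G c * ∏ w, φ w (c w))
    (hG : ∀ T : Finset {w : InfinitePlace L // IsComplex w}, (∀ w ∈ T, w ∉ insert w₀ S) → ∀ c, G (flipSet T c) = G c)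
    {g₀ : ℂ} (hGt : Tendsto G (𝓝[RegS (insert w₀ S)] (cayPt w₀ s)) (𝓝 g₀))
    {ℓ : {w : InfinitePlace L // IsComplex w} → ℂ}
    (hA0 : Tendsto (fun v : Fin 3 → ℝ => (((|Real.exp (v 0) - Real.exp (-v 0)| : ℝ) : ℂ) * φ w₀ v))
      (𝓝[{v : Fin 3 → ℝ | v 0 ≠ 0}] ![0, s w₀ 1, s w₀ 0]) (𝓝 (ℓ w₀)))
    (hsplit : ∀ w ∈ S, Tendsto (fun v : Fin 3 → ℝ => (((|Real.exp (v 0) - Real.exp (-v 0)| : ℝ) : ℂ) * φ w v))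
      (𝓝[{v : Fin 3 → ℝ | v 0 ≠ 0}] (s w)) (𝓝 (ℓ w)))
    (hcpt : ∀ w, w ∉ S → w ≠ w₀ → Tendsto (fun v : Fin 3 → ℝ => (1 - (Circle.exp (v 2 - v 0) : ℂ)) * (φ w v + φ w ![v 2, v 1, v 0]))
      (𝓝[{v : Fin 3 → ℝ | Circle.exp (v 0) ≠ Circle.exp (v 2)}] (s w)) (𝓝 (ℓ w))) :
    stOrbFamH L νH fH (insert w₀ S) (cayPt w₀ s) = g₀ * ∏ w, ℓ w := by
  refine stOrbFamH_insert_cayPt_eq_of_tendsto L νH fH S w₀ hreg hregS ?_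
  refine tendsto_archRH_mul_stableSum_of_prod (insert w₀ S) hP1 hG (cayPt w₀ s) hGt (fun w hw => ?_) (fun w hw => ?_)
  · rcases Finset.mem_insert.1 hw with h | h
    · subst h
      rwa [cayPt_eq_update_of_wall hs, Function.update_self]
    · have hne : w ≠ w₀ := fun h' => hw₀ (h' ▸ h)
      rw [cayPt_apply_of_ne hne]
      exact hsplit w h
  · rw [Finset.mem_insert, not_or] at hw
    rw [cayPt_apply_of_ne hw.1]
    exact hcpt w hw.2 hw.1

/-- **(I₂@cayPt) FROM PLAIN CONTINUITY AT THE OTHER PLACES**: same as `stOrbFamH_insert_cayPt_eq_mul_prod`, with the limits at the places `w ≠ w₀` SPELLED OUT from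
continuity of the local functionals `φ w` at the regular local points `s w` (and at the flipped triple for compact `w`): the Cayley-point value is
`g₀ · ℓ₀ · ∏_{w ∈ S} |e^{s_{w,0}} − e^{−s_{w,0}}| φ w (s w) · ∏_{w ∉ S, w ≠ w₀} (1 − e^{i(s_{w,2} − s_{w,0})}) (φ w (s w) + φ w (s w)^flip)`, written as one product over `w`.
[cite: Shelstad1979, Lemma 4.3 (p. 25); §4 p. 22–23] [cite: Bouaziz1994IntegralesOrbitales, §3.1 (I₂) p. 579] -/
theorem stOrbFamH_insert_cayPt_eq_mul_prod_of_continuousAt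
    (fH : ↥(arch (↥(maximalRealSubfield L)) L (IsCMField.complexConj L) 2 (Matrix.of fun i j : Fin 2 => if i.val + j.val + 1 = 2 then (1 : L) else 0)) ×
      ↥(arch (↥(maximalRealSubfield L)) L (IsCMField.complexConj L) 1 (Matrix.of fun i j : Fin 1 => if i.val + j.val + 1 = 1 then (1 : L) else 0)) → ℂ)
    (S : Finset {w : InfinitePlace L // IsComplex w}) {w₀ : {w : InfinitePlace L // IsComplex w}} (hw₀ : w₀ ∉ S)
    {s : {w : InfinitePlace L // IsComplex w} → Fin 3 → ℝ} (hs : s w₀ 0 = s w₀ 2)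
    (hreg : ∀ w, w ∉ S → w ≠ w₀ → Circle.exp (s w 0) ≠ Circle.exp (s w 2)) (hregS : ∀ w ∈ S, s w 0 ≠ 0)
    {G : ({w : InfinitePlace L // IsComplex w} → Fin 3 → ℝ) → ℂ} {φ : {w : InfinitePlace L // IsComplex w} → (Fin 3 → ℝ) → ℂ}
    (hP1 : ∀ c ∈ RegS (insert w₀ S), chartOrbH L νH (insert w₀ S) fH c = G c * ∏ w, φ w (c w))
    (hG : ∀ T : Finset {w : InfinitePlace L // IsComplex w}, (∀ w ∈ T, w ∉ insert w₀ S) → ∀ c, G (flipSet T c) = G c)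
    {g₀ : ℂ} (hGt : Tendsto G (𝓝[RegS (insert w₀ S)] (cayPt w₀ s)) (𝓝 g₀))
    {ℓ₀ : ℂ}
    (hA0 : Tendsto (fun v : Fin 3 → ℝ => (((|Real.exp (v 0) - Real.exp (-v 0)| : ℝ) : ℂ) * φ w₀ v))
      (𝓝[{v : Fin 3 → ℝ | v 0 ≠ 0}] ![0, s w₀ 1, s w₀ 0]) (𝓝 ℓ₀))
    (hsplit : ∀ w ∈ S, ContinuousAt (φ w) (s w))
    (hcpt : ∀ w, w ∉ S → w ≠ w₀ → ContinuousAt (φ w) (s w) ∧ ContinuousAt (φ w) ![s w 2, s w 1, s w 0]) :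
    stOrbFamH L νH fH (insert w₀ S) (cayPt w₀ s) =
      g₀ * ∏ w, (if w = w₀ then ℓ₀ else if w ∈ S then (((|Real.exp (s w 0) - Real.exp (-s w 0)| : ℝ) : ℂ) * φ w (s w))
        else (1 - (Circle.exp (s w 2 - s w 0) : ℂ)) * (φ w (s w) + φ w ![s w 2, s w 1, s w 0])) := by
  refine stOrbFamH_insert_cayPt_eq_mul_prod L νH fH S hw₀ hs hreg hregS hP1 hG hGt
    (ℓ := fun w => if w = w₀ then ℓ₀ else if w ∈ S then (((|Real.exp (s w 0) - Real.exp (-s w 0)| : ℝ) : ℂ) * φ w (s w))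
      else (1 - (Circle.exp (s w 2 - s w 0) : ℂ)) * (φ w (s w) + φ w ![s w 2, s w 1, s w 0])) ?_ (fun w hw => ?_) (fun w hw hne => ?_)
  · simpa only [if_true] using hA0
  · have hne : w ≠ w₀ := fun h => hw₀ (h ▸ hw)
    simp only [if_neg hne, if_pos hw]
    -- continuity of the local factor at the regular split point, restricted to the local regular set
    have hr : Continuous fun v : Fin 3 → ℝ => (((|Real.exp (v 0) - Real.exp (-v 0)| : ℝ) : ℂ)) := by
      fun_prop
    exact ((hr.continuousAt.mul (hsplit w hw)).continuousWithinAt).tendsto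
  · simp only [if_neg hne, if_neg hw]
    have hr : Continuous fun v : Fin 3 → ℝ => (1 - (Circle.exp (v 2 - v 0) : ℂ)) := by
      fun_prop
    have hflip : Continuous fun v : Fin 3 → ℝ => (![v 2, v 1, v 0] : Fin 3 → ℝ) := by
      fun_prop
    have h2 : ContinuousAt (fun v : Fin 3 → ℝ => φ w ![v 2, v 1, v 0]) (s w) :=
      ContinuousAt.comp (hcpt w hw hne).2 hflip.continuousAt
    exact ((hr.continuousAt.mul ((hcpt w hw hne).1.add h2)).continuousWithinAt).tendsto

end StOrbFamH

/-! ## §4 (EDITION 2, append-only) Docking glue for the `w₀`-slot and non-vanishing of the Cayley value -/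

section DockingGlue

/-- **DOCKING GLUE FOR THE BY-STATEMENT LIMITS**: a function that AGREES on the restricted set `A` with a function continuous at the base point tends, along `𝓝[A] x`,
to the continuous function's value — how an identity valid for `x_{w₀} ≠ 0` ((A0-b): `|eˣ−e⁻ˣ| · Φ^{T}_{hypBlockGL x θ}(f) = C · (chart integral)` with a chart integral
continuous in ALL local coordinates) discharges the `hA0` binder of `stOrbFamH_insert_cayPt_eq_mul_prod`, and how plain continuity at a regular local point discharges
`hsplit` ∕ `hcpt`. [cite: Bouaziz1994IntegralesOrbitales, §3.1 (I₂) p. 579] [cite: Shelstad1979, Lemma 4.3 (p. 25)] -/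
theorem tendsto_nhdsWithin_of_eqOn_of_continuousAt {X Y : Type*} [TopologicalSpace X] [TopologicalSpace Y] {A : Set X} {Lf R : X → Y} {x : X}
    (hLR : EqOn Lf R A) (hR : ContinuousAt R x) : Tendsto Lf (𝓝[A] x) (𝓝 (R x)) :=
  (hR.tendsto.mono_left nhdsWithin_le_nhds).congr' (eventuallyEq_nhdsWithin_of_eqOn hLR).symm

/-- The `w₀`-slot instance of the glue: if `|e^{v₀} − e^{−v₀}| · φ v = R v` for `v₀ ≠ 0` and `R` is continuous at the wall triple `t` (jointly in the three local
coordinates), then `|e^{v₀} − e^{−v₀}| · φ v → R t` within `{v | v₀ ≠ 0}` — the shape of `hA0`. [cite: Bouaziz1994IntegralesOrbitales, §3.1 (I₂) p. 579] -/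
theorem tendsto_absExpSub_mul_of_eqOn_of_continuousAt {φ R : (Fin 3 → ℝ) → ℂ} {t : Fin 3 → ℝ}
    (hLR : ∀ v : Fin 3 → ℝ, v 0 ≠ 0 → (((|Real.exp (v 0) - Real.exp (-v 0)| : ℝ) : ℂ) * φ v) = R v) (hR : ContinuousAt R t) :
    Tendsto (fun v : Fin 3 → ℝ => (((|Real.exp (v 0) - Real.exp (-v 0)| : ℝ) : ℂ) * φ v)) (𝓝[{v : Fin 3 → ℝ | v 0 ≠ 0}] t) (𝓝 (R t)) :=
  tendsto_nhdsWithin_of_eqOn_of_continuousAt (fun v hv => hLR v hv) hR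

end DockingGlue

section NonVanishing

open scoped Classical

variable (L : Type) [Field L] [NumberField L] [IsCMField L]
  [MeasurableSpace (↥(arch (↥(maximalRealSubfield L)) L (IsCMField.complexConj L) 2 (Matrix.of fun i j : Fin 2 => if i.val + j.val + 1 = 2 then (1 : L) else 0)) ×
      ↥(arch (↥(maximalRealSubfield L)) L (IsCMField.complexConj L) 1 (Matrix.of fun i j : Fin 1 => if i.val + j.val + 1 = 1 then (1 : L) else 0)))]
  [BorelSpace (↥(arch (↥(maximalRealSubfield L)) L (IsCMField.complexConj L) 2 (Matrix.of fun i j : Fin 2 => if i.val + j.val + 1 = 2 then (1 : L) else 0)) ×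
      ↥(arch (↥(maximalRealSubfield L)) L (IsCMField.complexConj L) 1 (Matrix.of fun i j : Fin 1 => if i.val + j.val + 1 = 1 then (1 : L) else 0)))]
  (νH : Measure (↥(arch (↥(maximalRealSubfield L)) L (IsCMField.complexConj L) 2 (Matrix.of fun i j : Fin 2 => if i.val + j.val + 1 = 2 then (1 : L) else 0)) ×
      ↥(arch (↥(maximalRealSubfield L)) L (IsCMField.complexConj L) 1 (Matrix.of fun i j : Fin 1 => if i.val + j.val + 1 = 1 then (1 : L) else 0))))
  [IsFiniteMeasureOnCompacts νH] [νH.IsMulRightInvariant]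

/-- **THE CAYLEY VALUE OF A PRODUCT READING IS NON-ZERO AS SOON AS EVERY LOCAL LIMIT IS** (`g₀ ≠ 0`, `ℓ w ≠ 0` for all `w`) — the form in which the organ J divides
the (K0±) jump by the Cayley value to FORCE the jump constant `jcH S w₀` from ONE product bump (`Finset.prod_ne_zero_iff`).
[cite: Shelstad1979, Lemma 4.3 (p. 25); Thm. 4.7 (IIIb) (p. 31)] [cite: Bouaziz1994IntegralesOrbitales, §3.2 (I₃) p. 580] -/
theorem stOrbFamH_insert_cayPt_ne_zero_of_prod
    (fH : ↥(arch (↥(maximalRealSubfield L)) L (IsCMField.complexConj L) 2 (Matrix.of fun i j : Fin 2 => if i.val + j.val + 1 = 2 then (1 : L) else 0)) ×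
      ↥(arch (↥(maximalRealSubfield L)) L (IsCMField.complexConj L) 1 (Matrix.of fun i j : Fin 1 => if i.val + j.val + 1 = 1 then (1 : L) else 0)) → ℂ)
    (S : Finset {w : InfinitePlace L // IsComplex w}) {w₀ : {w : InfinitePlace L // IsComplex w}} (hw₀ : w₀ ∉ S)
    {s : {w : InfinitePlace L // IsComplex w} → Fin 3 → ℝ} (hs : s w₀ 0 = s w₀ 2)
    (hreg : ∀ w, w ∉ S → w ≠ w₀ → Circle.exp (s w 0) ≠ Circle.exp (s w 2)) (hregS : ∀ w ∈ S, s w 0 ≠ 0)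
    {G : ({w : InfinitePlace L // IsComplex w} → Fin 3 → ℝ) → ℂ} {φ : {w : InfinitePlace L // IsComplex w} → (Fin 3 → ℝ) → ℂ}
    (hP1 : ∀ c ∈ RegS (insert w₀ S), chartOrbH L νH (insert w₀ S) fH c = G c * ∏ w, φ w (c w))
    (hG : ∀ T : Finset {w : InfinitePlace L // IsComplex w}, (∀ w ∈ T, w ∉ insert w₀ S) → ∀ c, G (flipSet T c) = G c)
    {g₀ : ℂ} (hGt : Tendsto G (𝓝[RegS (insert w₀ S)] (cayPt w₀ s)) (𝓝 g₀)) (hg₀ : g₀ ≠ 0)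
    {ℓ : {w : InfinitePlace L // IsComplex w} → ℂ} (hℓ : ∀ w, ℓ w ≠ 0)
    (hA0 : Tendsto (fun v : Fin 3 → ℝ => (((|Real.exp (v 0) - Real.exp (-v 0)| : ℝ) : ℂ) * φ w₀ v))
      (𝓝[{v : Fin 3 → ℝ | v 0 ≠ 0}] ![0, s w₀ 1, s w₀ 0]) (𝓝 (ℓ w₀)))
    (hsplit : ∀ w ∈ S, Tendsto (fun v : Fin 3 → ℝ => (((|Real.exp (v 0) - Real.exp (-v 0)| : ℝ) : ℂ) * φ w v))
      (𝓝[{v : Fin 3 → ℝ | v 0 ≠ 0}] (s w)) (𝓝 (ℓ w)))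
    (hcpt : ∀ w, w ∉ S → w ≠ w₀ → Tendsto (fun v : Fin 3 → ℝ => (1 - (Circle.exp (v 2 - v 0) : ℂ)) * (φ w v + φ w ![v 2, v 1, v 0]))
      (𝓝[{v : Fin 3 → ℝ | Circle.exp (v 0) ≠ Circle.exp (v 2)}] (s w)) (𝓝 (ℓ w))) :
    stOrbFamH L νH fH (insert w₀ S) (cayPt w₀ s) ≠ 0 := by
  rw [stOrbFamH_insert_cayPt_eq_mul_prod L νH fH S hw₀ hs hreg hregS hP1 hG hGt hA0 hsplit hcpt]
  exact mul_ne_zero hg₀ (Finset.prod_ne_zero_iff.2 fun w _ => hℓ w)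

end NonVanishing

end Literature.NumberTheory.Rogawski1990

end
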